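import Summits.Ventures.HSemireg.WedgeHankelRecurrenceDistinctRoots

/-!
# Venture HSemireg — HERMITE'S ROOT COUNT FOR A PRODUCT: INCLUSION–EXCLUSION OF HANKEL RANKS. For monic `m₁` (degree `t₁ + 1`), `m₂` (degree `t₂ + 1`) and their product (degree `(t₁ + t₂ + 1) + 1`):
# in characteristic `0`, **`rank H(m₁m₂) + #{common distinct roots} = rank H(m₁) + rank H(m₂)`** (where `rank H(m) := rank H_t(m′/m)` is N110's number of distinct roots), so the ranks ADD exactly for
# polynomials without a common root and `rank H(m²) = rank H(m)`; over EVERY field **`rank H(m₁m₂) ≤ rank H(m₁) + rank H(m₂)`** (a root whose multiplicities in `m₁` and `m₂` both vanish in `K` has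
# vanishing multiplicity in `m₁m₂`).

HONEST FRAMING. Part of the Lean index of the computation cell `pub-hsemireg` (seat p10 gen 32, Sunday typer «UNIFORM-IN-n»).
LINEAR ALGEBRA OF HANKEL (catalecticant) MATRICES and of polynomials over a field ONLY (`Polynomial.roots`, `Finset` inclusion–exclusion, the lineage's `hankelSq (dualSeq m m′)`): no variety, no
cohomology theory, no sheaf, no Ext group and no semiregularity map is constructed here; nothing here says that HC / HC_CM / HC_AV holds; no Literature fact is declared or used.  Custodian versions as
in `WedgeHankelSiegelIdeal` (1/3).

WHAT IS IN THE TREE.  N110 (`WedgeHankelRecurrenceDistinctRoots`, LANDED): `rank_hankelSq_dualSeq_derivative_eq_card_roots_toFinset_map` (characteristic `0`: `rank H_t(m′/m) = #distinct roots of φm`),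
`rank_hankelSq_dualSeq_derivative_eq_card_filter_map` (every characteristic: `= #{λ : e_λ ≠ 0 in L}`).  N118 (`NewtonSumsCalculus`, staged № 617): `p(m₁m₂) = p(m₁) + p(m₂)` — the Newton sums add,
but RANKS do not: this leaf quantifies the defect.  Mathlib: `roots_mul`, `Multiset.toFinset_add`, `Multiset.count_add`, `Finset.card_union_add_card_inter`, `Finset.card_union_le`, `Finset.filter_union`,
`Splits.mul`, `Monic.natDegree_mul`.  `rg`: no rank inclusion–exclusion statement in the tree.
THIS FILE (namespace `Summit.Ventures.HSemireg.Wedge.HankelOuter` continued; PLAIN on TREE N110; 0 definitions):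
* §698 `natDegree_mul_eq_of_monic_succ` (degrees of the product), **`rank_hankelSq_dualSeq_derivative_mul_add_card_inter`** (characteristic `0`: `rank H(m₁m₂) + #(Z(m₁) ∩ Z(m₂)) = rank H(m₁) + rank H(m₂)` under
  any splitting embedding of the product), `rank_hankelSq_dualSeq_derivative_mul_of_disjoint` (no common root ⇒ additive), `rank_hankelSq_dualSeq_derivative_mul_self` (`rank H(m·m) = rank H(m)`,
  characteristic `0`).
* §699 every characteristic: `filter_roots_mul_subset` (`{λ ∈ Z(m₁m₂) : e ≠ 0} ⊆ {λ ∈ Z(m₁) : e₁ ≠ 0} ∪ {λ ∈ Z(m₂) : e₂ ≠ 0}`), **`rank_hankelSq_dualSeq_derivative_mul_le_map`** (`rank H(m₁m₂) ≤ rank H(m₁) + rank H(m₂)`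
  under a splitting embedding), **`rank_hankelSq_dualSeq_derivative_mul_le`** (the same over `K`, through the splitting field of `m₁m₂`).
Nothing Ext-side.  New names only.
-/

open Module Polynomial
open scoped Matrix Polynomial

namespace Summit.Ventures.HSemireg.Wedge.HankelOuter

open Summit.Ventures.HSemireg.Wedge Summit.Ventures.HSemireg.Wedge.Hankel

variable (K : Type*) [Field K]

/-! ## §698. Characteristic `0`: inclusion–exclusion -/

/-- Degrees: `deg (m₁ m₂) = (t₁ + t₂ + 1) + 1` for monic `m₁`, `m₂` of degrees `t₁ + 1`, `t₂ + 1`. -/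
theorem natDegree_mul_eq_of_monic_succ {t₁ t₂ : ℕ} {m₁ m₂ : K[X]} (hm₁ : m₁.Monic) (hd₁ : m₁.natDegree = t₁ + 1) (hm₂ : m₂.Monic) (hd₂ : m₂.natDegree = t₂ + 1) : (m₁ * m₂).natDegree = (t₁ + t₂ + 1) + 1 := by
  rw [hm₁.natDegree_mul hm₂, hd₁, hd₂]; ring

/-- **INCLUSION–EXCLUSION OF HERMITE RANKS (characteristic `0`): `rank H(m₁m₂) + #(Z(φm₁) ∩ Z(φm₂)) = rank H(m₁) + rank H(m₂)`**, where `rank H(m) = rank H_t(m′/m)` (N110: the number of distinct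
roots) and `φ` is any embedding into a field of characteristic `0` under which `m₁` and `m₂` split. -/
theorem rank_hankelSq_dualSeq_derivative_mul_add_card_inter [DecidableEq K] {L : Type*} [Field L] [DecidableEq L] [CharZero L] (φ : K →+* L) {t₁ t₂ : ℕ} {m₁ m₂ : K[X]} (hm₁ : m₁.Monic)
    (hd₁ : m₁.natDegree = t₁ + 1) (hm₂ : m₂.Monic) (hd₂ : m₂.natDegree = t₂ + 1) (hs₁ : (m₁.map φ).Splits) (hs₂ : (m₂.map φ).Splits) :
    (hankelSq K (t₁ + t₂ + 1) (dualSeq K (m₁ * m₂) (derivative (m₁ * m₂)))).rank + ((m₁.map φ).roots.toFinset ∩ (m₂.map φ).roots.toFinset).card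
      = (hankelSq K t₁ (dualSeq K m₁ (derivative m₁))).rank + (hankelSq K t₂ (dualSeq K m₂ (derivative m₂))).rank := by
  have hs : ((m₁ * m₂).map φ).Splits := by rw [Polynomial.map_mul]; exact hs₁.mul hs₂
  rw [rank_hankelSq_dualSeq_derivative_eq_card_roots_toFinset_map K φ (hm₁.mul hm₂) (natDegree_mul_eq_of_monic_succ K hm₁ hd₁ hm₂ hd₂) hs, rank_hankelSq_dualSeq_derivative_eq_card_roots_toFinset_map K φ hm₁ hd₁ hs₁,
    rank_hankelSq_dualSeq_derivative_eq_card_roots_toFinset_map K φ hm₂ hd₂ hs₂, Polynomial.map_mul, Polynomial.roots_mul ((hm₁.map φ).mul (hm₂.map φ)).ne_zero, Multiset.toFinset_add,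
    Finset.card_union_add_card_inter]

/-- No common root ⇒ the ranks add: `rank H(m₁m₂) = rank H(m₁) + rank H(m₂)` (characteristic `0`). -/
theorem rank_hankelSq_dualSeq_derivative_mul_of_disjoint [DecidableEq K] {L : Type*} [Field L] [DecidableEq L] [CharZero L] (φ : K →+* L) {t₁ t₂ : ℕ} {m₁ m₂ : K[X]} (hm₁ : m₁.Monic)
    (hd₁ : m₁.natDegree = t₁ + 1) (hm₂ : m₂.Monic) (hd₂ : m₂.natDegree = t₂ + 1) (hs₁ : (m₁.map φ).Splits) (hs₂ : (m₂.map φ).Splits) (hdis : Disjoint (m₁.map φ).roots (m₂.map φ).roots) :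
    (hankelSq K (t₁ + t₂ + 1) (dualSeq K (m₁ * m₂) (derivative (m₁ * m₂)))).rank = (hankelSq K t₁ (dualSeq K m₁ (derivative m₁))).rank + (hankelSq K t₂ (dualSeq K m₂ (derivative m₂))).rank := by
  rw [← rank_hankelSq_dualSeq_derivative_mul_add_card_inter K φ hm₁ hd₁ hm₂ hd₂ hs₁ hs₂, Finset.disjoint_iff_inter_eq_empty.mp (Multiset.disjoint_toFinset.mpr hdis), Finset.card_empty, add_zero]

/-- `rank H(m·m) = rank H(m)` (characteristic `0`, `m` monic of degree `t + 1`, size `(t + t + 1) + 1` for the square): squaring does not change the number of distinct roots. -/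
theorem rank_hankelSq_dualSeq_derivative_mul_self [DecidableEq K] {L : Type*} [Field L] [DecidableEq L] [CharZero L] (φ : K →+* L) {t : ℕ} {m : K[X]} (hm : m.Monic) (hmd : m.natDegree = t + 1)
    (hs : (m.map φ).Splits) :
    (hankelSq K (t + t + 1) (dualSeq K (m * m) (derivative (m * m)))).rank = (hankelSq K t (dualSeq K m (derivative m))).rank := by
  have h := rank_hankelSq_dualSeq_derivative_mul_add_card_inter K φ hm hmd hm hmd hs hs
  rw [Finset.inter_self, ← rank_hankelSq_dualSeq_derivative_eq_card_roots_toFinset_map K φ hm hmd hs] at h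
  omega

/-! ## §699. Every characteristic: subadditivity -/

/-- `{λ ∈ Z(f₁ f₂) : e ≠ 0 in L} ⊆ {λ ∈ Z(f₁) : e₁ ≠ 0} ∪ {λ ∈ Z(f₂) : e₂ ≠ 0}` (`f₁ f₂ ≠ 0`): if both multiplicities vanish in `L`, so does their sum. -/
theorem filter_roots_mul_subset {L : Type*} [Field L] [DecidableEq L] {f₁ f₂ : L[X]} (h : f₁ * f₂ ≠ 0) :
    ((f₁ * f₂).roots.toFinset.filter fun c => (((f₁ * f₂).roots.count c : ℕ) : L) ≠ 0)
      ⊆ (f₁.roots.toFinset.filter fun c => ((f₁.roots.count c : ℕ) : L) ≠ 0) ∪ (f₂.roots.toFinset.filter fun c => ((f₂.roots.count c : ℕ) : L) ≠ 0) := by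
  intro c hc
  rw [Finset.mem_filter, Polynomial.roots_mul h, Multiset.count_add, Nat.cast_add] at hc
  rw [Finset.mem_union, Finset.mem_filter, Finset.mem_filter, Multiset.mem_toFinset, Multiset.mem_toFinset]
  by_contra hnot
  push Not at hnot
  apply hc.2
  have h1 : ((f₁.roots.count c : ℕ) : L) = 0 := by
    by_cases hm : c ∈ f₁.roots
    · exact hnot.1 hm
    · rw [Multiset.count_eq_zero_of_notMem hm, Nat.cast_zero]
  have h2 : ((f₂.roots.count c : ℕ) : L) = 0 := by
    by_cases hm : c ∈ f₂.roots
    · exact hnot.2 hm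
    · rw [Multiset.count_eq_zero_of_notMem hm, Nat.cast_zero]
  rw [h1, h2, add_zero]

/-- **SUBADDITIVITY IN EVERY CHARACTERISTIC: `rank H(m₁m₂) ≤ rank H(m₁) + rank H(m₂)`** under any embedding `φ` splitting both (N110's exact counts + §699's inclusion + `Finset.card_union_le`). -/
theorem rank_hankelSq_dualSeq_derivative_mul_le_map [DecidableEq K] {L : Type*} [Field L] [DecidableEq L] (φ : K →+* L) {t₁ t₂ : ℕ} {m₁ m₂ : K[X]} (hm₁ : m₁.Monic) (hd₁ : m₁.natDegree = t₁ + 1)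
    (hm₂ : m₂.Monic) (hd₂ : m₂.natDegree = t₂ + 1) (hs₁ : (m₁.map φ).Splits) (hs₂ : (m₂.map φ).Splits) :
    (hankelSq K (t₁ + t₂ + 1) (dualSeq K (m₁ * m₂) (derivative (m₁ * m₂)))).rank ≤ (hankelSq K t₁ (dualSeq K m₁ (derivative m₁))).rank + (hankelSq K t₂ (dualSeq K m₂ (derivative m₂))).rank := by
  have hs : ((m₁ * m₂).map φ).Splits := by rw [Polynomial.map_mul]; exact hs₁.mul hs₂
  rw [rank_hankelSq_dualSeq_derivative_eq_card_filter_map K φ (hm₁.mul hm₂) (natDegree_mul_eq_of_monic_succ K hm₁ hd₁ hm₂ hd₂) hs, rank_hankelSq_dualSeq_derivative_eq_card_filter_map K φ hm₁ hd₁ hs₁,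
    rank_hankelSq_dualSeq_derivative_eq_card_filter_map K φ hm₂ hd₂ hs₂, Polynomial.map_mul]
  exact (Finset.card_le_card (filter_roots_mul_subset ((hm₁.map φ).mul (hm₂.map φ)).ne_zero)).trans (Finset.card_union_le _ _)

/-- **`rank H(m₁m₂) ≤ rank H(m₁) + rank H(m₂)` over `K` itself, every field** (through the splitting field of `m₁ m₂`). -/
theorem rank_hankelSq_dualSeq_derivative_mul_le [DecidableEq K] {t₁ t₂ : ℕ} {m₁ m₂ : K[X]} (hm₁ : m₁.Monic) (hd₁ : m₁.natDegree = t₁ + 1) (hm₂ : m₂.Monic) (hd₂ : m₂.natDegree = t₂ + 1) :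
    (hankelSq K (t₁ + t₂ + 1) (dualSeq K (m₁ * m₂) (derivative (m₁ * m₂)))).rank ≤ (hankelSq K t₁ (dualSeq K m₁ (derivative m₁))).rank + (hankelSq K t₂ (dualSeq K m₂ (derivative m₂))).rank := by
  classical
  let L := (m₁ * m₂).SplittingField
  have hs : ((m₁ * m₂).map (algebraMap K L)).Splits := SplittingField.splits (m₁ * m₂)
  rw [Polynomial.map_mul] at hs
  have h0 : m₁.map (algebraMap K L) * m₂.map (algebraMap K L) ≠ 0 := ((hm₁.map _).mul (hm₂.map _)).ne_zero
  exact rank_hankelSq_dualSeq_derivative_mul_le_map K (algebraMap K L) hm₁ hd₁ hm₂ hd₂ (hs.of_dvd h0 (dvd_mul_right _ _)) (hs.of_dvd h0 (dvd_mul_left _ _))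

end Summit.Ventures.HSemireg.Wedge.HankelOuter
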